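import Summits.ABC.IUTFork.Repair.RHRound4TLinear
import HarnessLib

/-!
# INV-4 (lens `transfer`, Hodge–Arakelov / [EtTh] siblings) — the cheapest falsifier of the transferred lever, in Lean

abc-iut cell, crux `stmt-ABC-19678` `Summit.ABC.ABC.Theses.IUTThetaPilot.ThetaPartII`; seat abc-iut-inv-4 g1 (planner,
KEY `wake/KEY-abc-iut-inv-4-INV-TRANSFER-HA.md`). Companion to the memo `INV4-TRANSFER-DICTIONARY.md`.

THE TRANSFERRED LEVER. In Hodge–Arakelov theory the height inequality is obtained from ONE component of the comparison
morphism restricted to `Fil⁰`: a non-zero morphism of arithmetic line bundles `Fil⁰ → (label-j piece)` gives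
`deg Fil⁰ ≤ deg(piece_j)` for EACH label `j` with a non-zero component, SEPARATELY (abc_ver6 App. A.4; HASurI §1.1).
Ported to the R-H cell currency of record (`Round4TLinear.Variant`, p545946) such a LABEL-SEPARABLE licence at label `j`
is the scheme `singleLabel l j`: print's value law `j ↦ j²`, print's count `j ↦ j+1`, label set `{j}`, credit `1`.

WHAT IS TYPED (pure real arithmetic on the claim-tagged currency; no scheme is asserted to exist):
* `Estar_singleLabel` — its realised Szpiro-shape exponent is `E⋆ = 2l/(j−1)`;
* `six_le_Estar_singleLabel_iff` — `6 ≤ E⋆ ↔ 3(j−1) ≤ l`, i.e. a label-separable licence is inside the soundness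
  window of `L1CountFloor.six_le_Estar_iff` (Masser's floor, `Literature.Barriers.ABC.SzpiroEpsilonCannotBeDropped`)
  ONLY for `j ≤ l/3 + 1` — the bottom two terciles of `1 … l⋆`;
* `Estar_topLabel_107` — at the beds' `l = 107`, top label `j = l⋆ = 53`: `E⋆ = 107/26 (= 4.115…) < 6`;
  `unsound_labels_107` — at `l = 107` exactly the labels `37 ≤ j` (`≤ 53`) are outside the window (17 of 53).
READING (prose, not a theorem of this file): the I-2 portrait (I2-PORTRAIT-rh-kit-2 v1, Table «label range») puts
94.4 % · 98.5 % · 99.0 % of the optimum residual U2 (FREY133 · HEX79 · FREY482) in the top tercile `j > 2l⋆/3`, and at a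
budget-bound place the uncovered labels are a final segment ending at `l⋆`; `l⋆ ≤ l/3 + 1 ↔ l ≤ 9`, so for every `l ≥ 11`
datum with a residual the top label is outside the window of ANY label-separable licence — containment (P), one gauge
(G), one principal idele per label (G_j), per-label netting; the lever's in-window reach is the `l = 7` bin
(1.9 % · 0 % · 0.3 % of U2). Hence no line and no card from this lens (memo §4).

HONESTY: real arithmetic on OUR claim-tagged cell currency; a law fitted ≠ a theorem; computed ≠ proved; typed ≠ proved;
nothing here asserts abc proved or refuted; NO side is taken on [IUTchIII] Cor 3.12 / [IUTchIV] Thm 1.10 or on any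
author (D-0045); the link «`E⋆ < 6` ⇒ refuted by Masser» is the cell's READING of the currency (L1CountFloorSketch), not
a theorem of this file.
-/

open Finset

set_option linter.dupNamespace false

namespace Summit.ABC.ABC.Cruxes.ThetaPartII.INV4PerLabelFloor

open Summit.ABC.IUTFork.Repair.RH.Round4TLinear

/-- The HAT-transferred, LABEL-SEPARABLE licence at one label `j`, as a scheme of the cell currency: print's value law
`k ↦ k²`, print's count `k ↦ k + 1`, label set `{j}`, credit `μ₀ = 1`, prime `l`. [folklore] -/
noncomputable def singleLabel (l j : ℕ) : Variant where
  f := fun k => (k : ℤ) ^ 2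
  pk := fun k => (k : ℝ) + 1
  J := {j}
  μ₀ := 1
  l := l

theorem S_singleLabel (l j : ℕ) : S (singleLabel l j) = (j : ℝ) ^ 2 - 1 := by
  simp [S, singleLabel]

theorem countSum_singleLabel (l j : ℕ) : countSum (singleLabel l j) = (j : ℝ) + 1 := by
  simp [countSum, singleLabel]

/-- **The exponent of a one-label licence**: `E⋆(singleLabel l j) = 2l/(j−1)` (`j ≥ 2`). [folklore] -/
theorem Estar_singleLabel (l j : ℕ) (hj : 2 ≤ j) :
    Estar (singleLabel l j) = 2 * (l : ℝ) / ((j : ℝ) - 1) := by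
  have hj' : (2 : ℝ) ≤ j := by exact_mod_cast hj
  have hne1 : (j : ℝ) + 1 ≠ 0 := by intro h; linarith
  have hne2 : (j : ℝ) - 1 ≠ 0 := by intro h; linarith
  have hl : (singleLabel l j).l = l := rfl
  have hμ : (singleLabel l j).μ₀ = 1 := rfl
  unfold Estar
  rw [S_singleLabel, countSum_singleLabel, hl, hμ]
  have h1 : (j : ℝ) ^ 2 - 1 = ((j : ℝ) + 1) * ((j : ℝ) - 1) := by ring
  rw [h1]
  field_simp

/-- **The soundness window of a label-separable licence**: `6 ≤ E⋆ ↔ 3(j−1) ≤ l` (`j ≥ 2`), i.e. `j ≤ l/3 + 1`.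
Above it the one-label inequality has Szpiro-shape exponent `< 6` (cf. `L1CountFloor.six_le_Estar_iff`). [folklore] -/
theorem six_le_Estar_singleLabel_iff (l j : ℕ) (hj : 2 ≤ j) :
    6 ≤ Estar (singleLabel l j) ↔ 3 * ((j : ℝ) - 1) ≤ l := by
  rw [Estar_singleLabel l j hj]
  have hpos : 0 < (j : ℝ) - 1 := by
    have : (2 : ℝ) ≤ j := by exact_mod_cast hj
    linarith
  rw [le_div_iff₀ hpos]
  constructor <;> intro h <;> linarith

/-- The same window in natural numbers: `6 ≤ E⋆ ↔ 3j ≤ l + 3`. [folklore] -/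
theorem six_le_Estar_singleLabel_iff_nat (l j : ℕ) (hj : 2 ≤ j) :
    6 ≤ Estar (singleLabel l j) ↔ 3 * j ≤ l + 3 := by
  rw [six_le_Estar_singleLabel_iff l j hj]
  constructor
  · intro h
    have h' : (3 : ℝ) * j ≤ (l : ℝ) + 3 := by linarith
    exact_mod_cast h'
  · intro h
    have h' : ((3 * j : ℕ) : ℝ) ≤ ((l + 3 : ℕ) : ℝ) := by exact_mod_cast h
    push_cast at h'
    linarith

/-- **At the beds' `l = 107`, the top label `j = l⋆ = 53`**: `E⋆ = 214/52 = 107/26 (= 4.115…)`. [folklore] -/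
theorem Estar_topLabel_107 : Estar (singleLabel 107 53) = 107 / 26 := by
  rw [Estar_singleLabel 107 53 (by norm_num)]
  norm_num

/-- … which is outside the soundness window: `E⋆ < 6`. [folklore] -/
theorem Estar_topLabel_107_lt_six : Estar (singleLabel 107 53) < 6 := by
  rw [Estar_topLabel_107]; norm_num

/-- **The unsound labels at `l = 107`** (`2 ≤ j`): a one-label licence is outside the window iff `37 ≤ j`
(so for the labels `37 … 53` of `1 … l⋆ = 53`: 17 of 53, the top tercile being `36 … 53`). [folklore] -/
theorem unsound_labels_107 (j : ℕ) (hj : 2 ≤ j) :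
    Estar (singleLabel 107 j) < 6 ↔ 37 ≤ j := by
  have h := six_le_Estar_singleLabel_iff_nat 107 j hj
  constructor
  · intro hlt
    by_contra hc
    push Not at hc
    have : 3 * j ≤ 107 + 3 := by omega
    have := h.2 this
    linarith
  · intro hge
    by_contra hc
    push Not at hc
    have := h.1 hc
    omega

/-- In the large-`l` limit the top label `j = l⋆ = (l−1)/2` has `E⋆ = 4l/(l−3)` (→ 4): stated at `l = 2k+1`,
`j = k ≥ 2`: `E⋆ = 2(2k+1)/(k−1)`. [folklore] -/
theorem Estar_topLabel (k : ℕ) (hk : 2 ≤ k) :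
    Estar (singleLabel (2 * k + 1) k) = 2 * ((2 * k + 1 : ℕ) : ℝ) / ((k : ℝ) - 1) :=
  Estar_singleLabel (2 * k + 1) k hk

end Summit.ABC.ABC.Cruxes.ThetaPartII.INV4PerLabelFloor
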